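/-
Copyright (c) 2026 the pub-hodgecm-mathlib formalisation cell (harness21).  Prover seat hodgecm-mathlib-F0P3a-p01 (g39), explicit-unit SUPPORTS-ONLY on h413, req620 Track A
«(D-RAM) FOUR-FRAME» squad ((β₂) road (R-36) «RAY BANDS», lane A (Unr-K) port: LH4-p19 (g3)'s ★ W2 `exists_cellLetters` AT ANY RADIUS — the parity `j = b + 2n` and the
integrality `|κ₀| ≤ 1` replaced by `j = b + r`, `|ξ₀| = e^r`, `|κ₀| ≤ |ξ₀|` = the engine map's (R2)(R3); lane-free), 2026-09-05.
-/
import Summits.HodgeConjecture.HodgeConjecture.Theorems.F0P3cDyRamUpperRayCellLetters   -- ★ p864626 (LH4-p19 (g3)) W2: the even-radius ∕ integral-κ₀ statement this file generalises; brings ★ F3 `…UpperLineCellCentre`, ★ Lit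
import HarnessLib

/-!
# Crux `H413`, line LH4 «(D-RAM) FOUR-FRAME» — (β₂) road «RAY BANDS», lane-free: «THE CELL LETTERS OF AN UPPER-LINE RAY ∩ LOW CELL AT ANY RADIUS» —
# `exists_cellLetters_of_radius` = ★ W2 `…UpperRayCellLetters.exists_cellLetters` with `(hjbn : j = b + 2n) (hκ₀1 : |κ₀| ≤ 1) (hξv : |ξ₀| = e^{2n})` ↦ `(hjbr : j = b + r) (hκ₀v : |κ₀| ≤ |ξ₀|) (hξv : |ξ₀| = e^r)`

Cell `hodgecm-mathlib` (D-0151), FLOOR 0, crux item H413 = `stmt-HodgeConjecture-24833`, route of record `HCCMUnconditional`; squad F0∕P3c∕LH4; lane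
`--supports stmt-HodgeConjecture-24833 --as helper` (count-neutral; pays NO tier-0 row).  THEOREMS ONLY (no `def`, no instance, no notation, no `sorry`, default heartbeats);
★-only imports; states NO law; (β₂) stays a HYPOTHESIS.  Frame = ★ W2's VERBATIM (opened ‹OFF.letter.v2›∕‹OFF-A.letter.v2› letters: the E-datum, the `jE`-letters, `ρ`, `Θ`, the
line model's `lam`, `tr`, `det`, the deep token `|lam − 1| ≤ |ϖE|^{3d−2}`, the `u`-entry, the sizes `|μ| = e^{−m}`, `|μ − ρμ| = e^{−jl}`, the upper-line RAY ∩ LOW cell) — lane-free.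

WHY (LH4-p19 (g3) RAYBANDS ENGINE MAP v1 `F0/P3c/LH4/LH4-p19/g3/RAYBANDS-ENGINE-MAP.v1.LH4p19g3.md` §«reference-pair interface»; this seat's ★ p864921 ∕ `…UnrKThetaFixedRefPair`).
★ W2 states the cell letters at an EVEN radius `j = b + 2n`, `|ξ₀| = e^{2n}` (lane B's parity, ★ W2 §1 via the ramified M-datum) and with an INTEGRAL chart point `|κ₀| ≤ 1`
(lane B's ★ `exists_refPair_of_frame`).  Its proof reads the parity ONLY through `jl = m + (j − b)` and the integrality ONLY through `|κ₀| ≤ |ξ₀|` (the bound `|W| ≤ 1`).  In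
lane A (type U ∕ Unr-K) the HYPERBOLIC tower sits at `j − b = d + 2i` (★ p861798 §3 — parity of `d`) and the Θ-fixed chart point has `|κ₀| = exp(d − 1) > 1` (★ p864921,
`…UnrKThetaFixedRefPair`), with `|κ₀| ≤ |ξ₀| = e^{j−b}` on the whole tower.  THIS FILE re-types ★ W2's HEAD at ANY radius `r = j − b` with the chart letters `(R1)` VERBATIM,
`(R2)` `|ξ₀| = e^r`, `(R3)` `|κ₀| ≤ |ξ₀|` — proof = ★ W2's TOKEN FOR TOKEN with `2n ↦ r` (four lines) and the `|W| ≤ 1` step closed by `hκ₀v` directly; conclusion BYTE FOR BYTE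
★ W2's.  Lane B recovers ★ W2 at `r := 2n`, `hκ₀v := hκ₀1.trans (1 ≤ e^{2n})`; lane A instantiates it on the tower with `…UnrKThetaFixedRefPair.exists_theta_refPair_of_typeU`.
HONEST LABEL.  Count-neutral algebra; nothing printed is asserted; no census law is stated; `hU_ray`∕`hD_ray` (lane B ★ p864786), ‹LINE-U-A-RAY›∕‹LINE-L-A-RAY› (lane A) and (β₂)
stay as they are (β₂ UNPROVED); `HC_CM` is proved only modulo the 7 printed citations (2 remaining named inputs: hLiu418 = `stmt-HodgeConjecture-24832`, h413 =
`stmt-HodgeConjecture-24833`) until rung 0 closes.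
## References
* [Kottwitz1986BaseChangeUnits] R. E. Kottwitz, *Base change for unit elements of Hecke algebras*, Compositio Math. 60 (1986): §3 (the cell constants of a cone cell).
* [Serre1979] J.-P. Serre, *Local Fields*, GTM 67 (1979): Ch. III §6 Prop. 12 (Eisenstein coordinates), Ch. V §3, Ch. XV §2.
* [Rogawski1990] J. D. Rogawski, *Automorphic Representations of Unitary Groups in Three Variables*, Ann. of Math. Stud. 123 (1990): §4.9 Prop. 4.9.1 (b) p. 55, §12.2.
-/

set_option autoImplicit false

noncomputable section

namespace Summit.HodgeConjecture.HodgeConjecture.Cruxes.H413.F0P3cDyRamUpperRayCellLettersAnyRadius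

open scoped Valued WithZero
open WithZero
open Literature.NumberTheory.Automorphic.UnitaryThreeFourFrame (IsRamifiedQuadraticDatum)
open Literature.NumberTheory.LocalFields.WildQuadraticDatum (v_eq_one_of_v_mul_map_eq_one)
open Literature.NumberTheory.Rogawski1990
open Summit.HodgeConjecture.HodgeConjecture.Cruxes.H413.F0P3cDyRamToricCensusDefs
open Summit.HodgeConjecture.HodgeConjecture.Cruxes.H413.F0P3cDyRamUpperLineCellCentre

variable {E M : Type} [Field E] [Valued E ℤᵐ⁰] [Field M] [Valued M ℤᵐ⁰] {ρ Θ : M →+* M} {α : M}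

/-- **HEAD — «THE CELL LETTERS OF AN UPPER-LINE RAY ∩ LOW CELL AT ANY RADIUS».**  ★ W2 `exists_cellLetters` with the cell at radius `r = j − b` (`j = b + r`, `|ξ₀| = e^r`) and
the chart bound `|κ₀| ≤ |ξ₀|` in place of `|κ₀| ≤ 1`; outputs `W B γ₁ W₁ : E` with ★ W2's eleven letters BYTE FOR BYTE (`jE W·ξ₀ = ρμ∕(ρμ − μ) − κ₀`; `jE B = (μ − ρμ)·ξ₀`;
`σγ₁ = γ₁`; `σW₁ = W₁`; SLOPE; ROOT; the digit sizes; `|W₁| ≤ 1`).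
[cite: Kottwitz1986BaseChangeUnits, §3] [cite: Serre1979, Ch. III §6 Prop. 12; Ch. XV §2] [cite: Rogawski1990, §4.9 Prop. 4.9.1 (b) p. 55] -/
theorem exists_cellLetters_of_radius {σ : E →+* E} {ϖ : E} {d tE : ℕ} (hD : IsRamifiedQuadraticDatum σ ϖ d tE)
    (jE : E →+* M) (hjiso : ∀ a, Valued.v (jE a) = Valued.v a) (hjfix : ∀ z, ρ z = z ↔ ∃ c, jE c = z) (hΘj : ∀ c, Θ (jE c) = jE (σ c))
    (hρρ : ∀ x, ρ (ρ x) = x) (hvρ : ∀ x, Valued.v (ρ x) = Valued.v x) (hΘρ : ∀ x, Θ (ρ x) = ρ (Θ x))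
    {lam : M} (hΘlam : Θ lam * lam = 1) (hvlam : Valued.v lam = 1)
    {tr det : E} (hdet : det * σ det = 1) (hlam2 : lam * lam = jE tr * lam - jE det) (hρlam : ρ lam = jE tr - lam)
    (hlam3 : Valued.v (lam - 1) ≤ Valued.v (jE ϖ) ^ (3 * d - 2))
    {u : E} (huu : u * σ u = 1) (hu : Valued.v u = 1)
    {m jl : ℕ} (hm : Valued.v (lam - jE u) = exp (-(m : ℤ))) (hjl : Valued.v ((lam - jE u) - ρ (lam - jE u)) = exp (-(jl : ℤ)))
    {j b r : ℕ} (hjbr : j = b + r) (hline : j + m = jl + b) (h2bm : m < 2 * b) (hray : d % 2 + 2 * d - 1 + b ≤ m)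
    (hlow : 3 * d - 2 + d % 2 + 2 * b ≤ 2 * m)
    {κ₀ ξ₀ : M} (hκ₀ : κ₀ + ρ κ₀ = 1) (hΘκ₀ : Θ κ₀ = κ₀) (hξ : ρ ξ₀ = -ξ₀) (hΘξ : Θ ξ₀ = ξ₀) (hξ0 : ξ₀ ≠ 0)
    (hκ₀v : Valued.v κ₀ ≤ Valued.v ξ₀) (hξv : Valued.v ξ₀ = exp (r : ℤ)) :
    ∃ W BE γ₁ W₁ : E,
      jE W * ξ₀ = ρ (lam - jE u) / (ρ (lam - jE u) - (lam - jE u)) - κ₀ ∧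
      jE BE = ((lam - jE u) - ρ (lam - jE u)) * ξ₀ ∧ σ γ₁ = γ₁ ∧ σ W₁ = W₁ ∧
      Valued.v (BE / ((ϖ * σ ϖ) ^ b * ((ϖ - σ ϖ) * ((ϖ * σ ϖ) ^ ((d - d % 2) / 2))⁻¹)) - γ₁) ≤ Valued.v γ₁ * Valued.v ϖ ^ (2 * d - 1) ∧
      Valued.v (γ₁ * (W - W₁)) ≤ Valued.v ϖ ^ (2 * d - 1) ∧
      Valued.v γ₁ * Valued.v ϖ ^ b = Valued.v ϖ ^ (m - b - d % 2) ∧ 1 ≤ Valued.v γ₁ ∧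
      Valued.v γ₁ * Valued.v ϖ ^ b ≤ Valued.v ϖ ^ (2 * d - 1) ∧ Valued.v ϖ ^ (2 * d - 2) ≤ Valued.v γ₁ * Valued.v ϖ ^ (2 * d - 1) ∧
      Valued.v W₁ ≤ 1 := by
  obtain ⟨hσσ, hvσ, hϖ, -, hd, hd1, -⟩ := id hD
  have hvϖ0 : Valued.v ϖ ≠ 0 := by rw [hϖ]; exact exp_ne_zero
  have hϖ0 : ϖ ≠ 0 := fun h0 => hvϖ0 (by rw [h0, map_zero])
  have hϖpos : (0 : ℤᵐ⁰) < Valued.v ϖ := zero_lt_iff.2 hvϖ0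
  have hϖlt : Valued.v ϖ < 1 := by rw [hϖ, ← exp_zero, exp_lt_exp]; norm_num
  have hσϖ0 : σ ϖ ≠ 0 := (map_ne_zero σ).2 hϖ0
  have hPnE : ∀ k : ℕ, Valued.v ϖ ^ k = exp (-(k : ℤ)) := fun k => by rw [hϖ, ← exp_nsmul]; congr 1; simp
  have hρj : ∀ c : E, ρ (jE c) = jE c := fun c => (hjfix _).2 ⟨c, rfl⟩
  have hϖσ : σ ϖ ≠ ϖ := fun h => by rw [h, sub_self, map_zero] at hd; exact pow_ne_zero _ hvϖ0 hd.symm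
  have hjl2 : (jl : ℤ) = r + m := by push_cast [hjbr] at hline ⊢; omega
  have hμρ : ρ (lam - jE u) ≠ lam - jE u := fun h => by
    rw [h, sub_self, map_zero] at hjl; exact exp_ne_zero hjl.symm
  have hξpos : (0 : ℤᵐ⁰) < Valued.v ξ₀ := zero_lt_iff.2 ((Valuation.ne_zero_iff _).2 hξ0)
  -- the centre coordinate and the slope
  obtain ⟨W, hWc⟩ := exists_centre_coord jE hjfix hρρ hμρ hκ₀ hξ hξ0
  have hρB : ρ (((lam - jE u) - ρ (lam - jE u)) * ξ₀) = ((lam - jE u) - ρ (lam - jE u)) * ξ₀ := by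
    rw [map_mul, map_sub, hρρ, hξ]; ring
  obtain ⟨BE, hBE⟩ := (hjfix _).1 hρB
  -- determinant letters
  have hdetv : Valued.v det = 1 := v_eq_one_of_v_mul_map_eq_one hvσ (by rw [hdet]; exact map_one _)
  have hdet0 : det ≠ 0 := fun h0 => by rw [h0, map_zero] at hdetv; exact zero_ne_one hdetv
  have hll : lam * ρ lam = jE det := by
    have e : lam * ρ lam = jE tr * lam - lam * lam := by rw [hρlam]; ring
    rw [e, hlam2]; ring
  have hdet1 : Valued.v (det - 1) ≤ Valued.v ϖ ^ (3 * d - 2) := by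
    rw [← hjiso, map_sub, map_one, ← hll, ← hjiso ϖ]
    have e : lam * ρ lam - 1 = (lam - 1) * ρ lam + ρ (lam - 1) := by rw [map_sub, map_one]; ring
    rw [e]
    refine (Valuation.map_add _ _ _).trans (max_le ?_ ?_)
    · rw [Valuation.map_mul, hvρ, hvlam, mul_one]; exact hlam3
    · rw [hvρ]; exact hlam3
  -- `σ` of the slope: `σB = −B ∕ det`
  have hl0 : lam ≠ 0 := fun h0 => by rw [h0, map_zero] at hvlam; exact zero_ne_one hvlam
  have hρl0 : ρ lam ≠ 0 := fun h0 => hl0 (by rw [← hρρ lam, h0, map_zero])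
  have hσBE : σ BE = -BE / det := jE.injective (by
    rw [← hΘj, map_div₀, map_neg, hBE, map_mul, hΘξ, ← hll, map_skew_eq_neg_div σ jE hΘj hρj hΘρ hΘlam huu]
    field_simp)
  set P : E := (ϖ * σ ϖ) ^ b with hPdef
  set tp : E := (ϖ - σ ϖ) * ((ϖ * σ ϖ) ^ ((d - d % 2) / 2))⁻¹ with htpdef
  have hσP : σ P = P := by rw [hPdef, map_pow, map_mul, hσσ, mul_comm (σ ϖ) ϖ]
  have hσtp : σ tp = -tp := by
    rw [htpdef, map_mul, map_inv₀, map_pow, map_mul, map_sub, hσσ, mul_comm (σ ϖ) ϖ]; ring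
  have hP0 : P ≠ 0 := pow_ne_zero _ (mul_ne_zero hϖ0 hσϖ0)
  have hPv : Valued.v P = Valued.v ϖ ^ (2 * b) := by rw [hPdef, Valuation.map_pow, Valuation.map_mul, hvσ, ← pow_two, ← pow_mul]
  have htpv : Valued.v tp = Valued.v ϖ ^ (d % 2) := by
    have h1 : Valued.v tp * Valued.v ϖ ^ (2 * ((d - d % 2) / 2)) = Valued.v ϖ ^ d := by
      rw [htpdef, Valuation.map_mul, Valuation.map_inv, Valuation.map_pow, Valuation.map_mul, hvσ, ← pow_two, ← pow_mul, hd,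
        inv_mul_cancel_right₀ (pow_ne_zero _ hvϖ0)]
    have h2 : Valued.v ϖ ^ d = Valued.v ϖ ^ (d % 2) * Valued.v ϖ ^ (2 * ((d - d % 2) / 2)) := by rw [← pow_add]; congr 1; omega
    exact mul_right_cancel₀ (pow_ne_zero _ hvϖ0) (h1.trans h2)
  have htp0 : tp ≠ 0 := fun h0 => by rw [h0, map_zero] at htpv; exact pow_ne_zero _ hvϖ0 htpv.symm
  -- the slope ratio `θ` and its `σ`
  set θ : E := BE / (P * tp) with hθdef
  have hBE0 : BE ≠ 0 := fun h0 => by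
    have : ((lam - jE u) - ρ (lam - jE u)) * ξ₀ = 0 := by rw [← hBE, h0, map_zero]
    exact mul_ne_zero (sub_ne_zero.2 (Ne.symm hμρ)) hξ0 this
  have hθ0 : θ ≠ 0 := div_ne_zero hBE0 (mul_ne_zero hP0 htp0)
  have hθpos : (0 : ℤᵐ⁰) < Valued.v θ := zero_lt_iff.2 ((Valuation.ne_zero_iff _).2 hθ0)
  have hσθ : σ θ = θ / det := by
    rw [hθdef, map_div₀, map_mul, hσBE, hσP, hσtp]; field_simp
  have hθσv : Valued.v (θ - σ θ) ≤ Valued.v θ * Valued.v ϖ ^ (3 * d - 2) := by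
    have e : θ - σ θ = θ * ((det - 1) / det) := by rw [hσθ]; field_simp
    rw [e, Valuation.map_mul, map_div₀ _ (det - 1) det, hdetv, div_one]; exact mul_le_mul' le_rfl hdet1
  -- Eisenstein approximation of the slope ratio
  obtain ⟨γ₁, hσγ, hγ⟩ := exists_fixed_v_sub_mul_eq hσσ hϖσ θ
  have hθγ : Valued.v (θ - γ₁) ≤ Valued.v θ * Valued.v ϖ ^ (2 * d - 1) := by
    have h1 : Valued.v (θ - γ₁) * Valued.v ϖ ^ d ≤ Valued.v θ * Valued.v ϖ ^ (2 * d - 1) * Valued.v ϖ ^ d := by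
      rw [← hd, hγ]
      calc Valued.v (θ - σ θ) * Valued.v ϖ ≤ Valued.v θ * Valued.v ϖ ^ (3 * d - 2) * Valued.v ϖ := mul_le_mul' hθσv le_rfl
        _ = Valued.v θ * Valued.v ϖ ^ (2 * d - 1) * Valued.v (ϖ - σ ϖ) := by
          rw [hd, mul_assoc, mul_assoc, ← pow_succ, ← pow_add]; congr 2; omega
    have h2 := (div_le_iff₀ (pow_pos hϖpos d)).2 h1
    rwa [mul_div_assoc, div_self (pow_ne_zero _ hvϖ0), mul_one] at h2
  have h2d1 : Valued.v ϖ ^ (2 * d - 1) < 1 := pow_lt_one₀ zero_le hϖlt (by omega)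
  have hθlt : Valued.v (θ - γ₁) < Valued.v θ :=
    hθγ.trans_lt (by
      calc Valued.v θ * Valued.v ϖ ^ (2 * d - 1) < Valued.v θ * 1 := mul_lt_mul_of_pos_left h2d1 hθpos
        _ = Valued.v θ := mul_one _)
  have hγv : Valued.v γ₁ = Valued.v θ := by
    have e : γ₁ = θ - (θ - γ₁) := by ring
    rw [e, Valuation.map_sub_eq_of_lt_left _ hθlt]
  -- the size of `θ`: `|θ| = e^{2b + ℓ₀ − m}`
  have hBEv : Valued.v BE = exp (-(jl : ℤ)) * exp (r : ℤ) := by rw [← hjiso, hBE, Valuation.map_mul, hjl, hξv]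
  have hθv : Valued.v θ = exp (2 * (b : ℤ) + (d % 2 : ℕ) - m) := by
    rw [hθdef, Valuation.map_div, Valuation.map_mul, hBEv, hPv, htpv, hPnE, hPnE, ← exp_add, ← exp_add, ← exp_sub]
    congr 1; push_cast; omega
  -- the root: `|W − σW| = e^{−m}`, Eisenstein `W₁`
  have hκcv : Valued.v (ρ (lam - jE u) / (ρ (lam - jE u) - (lam - jE u))) = exp (r : ℤ) := by
    rw [v_centre_eq hvρ (lam - jE u), hm, hjl, ← exp_sub]; congr 1; omega
  have hWσ : Valued.v (W - σ W) = exp (-(m : ℤ)) := by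
    have h1 := map_centre_coord_sub σ jE hΘj hΘκ₀ hΘξ hWc
    have h3 : ρ (lam - jE u) / (ρ (lam - jE u) - (lam - jE u)) - Θ (ρ (lam - jE u) / (ρ (lam - jE u) - (lam - jE u))) =
        -(ρ (lam - jE u) / (ρ (lam - jE u) - (lam - jE u)) * ((lam - jE u) / jE u)) := by
      rw [← neg_sub, map_centre_sub_centre σ jE hΘj hρj hΘρ hΘlam huu hμρ]
    have h2 : Valued.v (W - σ W) * Valued.v ξ₀ = exp (-(m : ℤ)) * Valued.v ξ₀ := by
      rw [← hjiso (W - σ W), ← Valuation.map_mul, h1.trans h3, Valuation.map_neg, Valuation.map_mul, hκcv, Valuation.map_div, hm,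
        hjiso u, hu, div_one, hξv, mul_comm]
    exact mul_right_cancel₀ ((Valuation.ne_zero_iff _).2 hξ0) h2
  obtain ⟨W₁, hσW₁, hW1⟩ := exists_fixed_v_sub_mul_eq hσσ hϖσ W
  have hWWv : Valued.v (W - W₁) = exp (-(m : ℤ) - 1 + d) := by
    have h1 : Valued.v (W - W₁) * exp (-(d : ℤ)) = exp (-(m : ℤ) + (-1)) := by rw [← hPnE, ← hd, hW1, hWσ, hϖ, exp_add]
    rw [(eq_mul_inv_iff_mul_eq₀ exp_ne_zero).2 h1, ← exp_neg, ← exp_add]; congr 1; ring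
  have hWW : Valued.v (γ₁ * (W - W₁)) ≤ Valued.v ϖ ^ (2 * d - 1) := by
    rw [Valuation.map_mul, hγv, hθv, hWWv, ← exp_add, hPnE, exp_le_exp]; push_cast; omega
  have hWle : Valued.v W ≤ 1 := by
    have h1 : Valued.v (jE W) * Valued.v ξ₀ ≤ 1 * Valued.v ξ₀ := by
      rw [← Valuation.map_mul, hWc, one_mul]
      exact (Valuation.map_sub _ _ _).trans (max_le (by rw [hκcv, hξv]) hκ₀v)
    have h2 := (le_div_iff₀ hξpos).2 h1
    rwa [mul_div_assoc, div_self (ne_of_gt hξpos), mul_one, hjiso] at h2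
  have hW₁1 : Valued.v W₁ ≤ 1 := by
    have e : W₁ = W - (W - W₁) := by ring
    rw [e]
    refine (Valuation.map_sub _ _ _).trans (max_le hWle ?_)
    rw [hWWv, ← exp_zero, exp_le_exp]; omega
  -- the digit sizes
  have hγn : Valued.v γ₁ * Valued.v ϖ ^ b = Valued.v ϖ ^ (m - b - d % 2) := by
    rw [hγv, hθv, hPnE, hPnE, ← exp_add, exp_inj]; push_cast; omega
  have hγ1 : 1 ≤ Valued.v γ₁ := by rw [hγv, hθv, ← exp_zero, exp_le_exp]; push_cast; omega
  have hγr : Valued.v γ₁ * Valued.v ϖ ^ b ≤ Valued.v ϖ ^ (2 * d - 1) := by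
    rw [hγv, hθv, hPnE, hPnE, ← exp_add, exp_le_exp]; push_cast; omega
  have hγe : Valued.v ϖ ^ (2 * d - 2) ≤ Valued.v γ₁ * Valued.v ϖ ^ (2 * d - 1) := by
    rw [hγv, hθv, hPnE, hPnE, ← exp_add, exp_le_exp]; push_cast; omega
  exact ⟨W, BE, γ₁, W₁, hWc, hBE, hσγ, hσW₁, by rw [hγv]; exact hθγ, hWW, hγn, hγ1, hγr, hγe, hW₁1⟩


end Summit.HodgeConjecture.HodgeConjecture.Cruxes.H413.F0P3cDyRamUpperRayCellLettersAnyRadius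

end
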